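import Mathlib
import Summits.KontsevichZagierPeriods.Zeta5Search.ProfileA5p1745CellsA
import Summits.KontsevichZagierPeriods.Zeta5Search.ProfileA5p1745CellsB
import Summits.KontsevichZagierPeriods.Zeta5Search.ProfileA5p172634CellsA
import Summits.KontsevichZagierPeriods.Zeta5Search.ProfileA5p172634CellsB
import Summits.KontsevichZagierPeriods.Zeta5Search.ProfileA5p1734CellsA
import Summits.KontsevichZagierPeriods.Zeta5Search.ProfileA5p1734CellsB
import Summits.KontsevichZagierPeriods.Zeta5Search.DenomLaw.Profile15aPath
import Summits.KontsevichZagierPeriods.Zeta5Search.DenomLaw.PathWeightProfile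
import Summits.KontsevichZagierPeriods.Zeta5Search.DenomLaw.VGainPalCoverKit
import Summits.KontsevichZagierPeriods.Zeta5Search.DenomLaw.Profile11PathA
import Summits.KontsevichZagierPeriods.Zeta5Search.DenomLaw.LawA3KCoverKit
import Summits.KontsevichZagierPeriods.Zeta5Search.DenomLaw.LawA4CoverKit
import Summits.KontsevichZagierPeriods.Zeta5Search.DenomLaw.Profile12PathA
import Summits.KontsevichZagierPeriods.Zeta5Search.DenomLaw.Profile13PathB
import Summits.KontsevichZagierPeriods.Zeta5Search.DenomLaw.Profile9PathA
import HarnessLib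

/-!
# ζ(5) search — a < 7 PROFILES `A5P1745`, `A5P172634`, `A5P1734` for EVERY sorted parameter vector at depth `d < 2p` (DENOM-LAW D1, prover-d1 gen 24; generated by gen 23's `gen_pathGEN.py` + gen 24's LB♯ / J laws)

Cell `pub-zeta5` (HONEST FRAMING: systematic search; no irrationality claim unless certified), TRACK «DENOM-LAW» D1 prover seat (denom-prover-d1
gen 23, `HOME/denom-law/prover-d1/ATTEMPT-23.md`; path generator `g23/gen/path23/gen_pathGEN.py`, cover specs `g23/gen/specs/`).  The a = 6 stratum
(`b₇ < p ≤ b₆`: 9,264 / 13,757 first-period instances at p = 7 / 11) after `ProfileA6TopPath` / `ProfileA6u47Path`: the profiles `A5P1745`, `A5P172634`, `A5P1734` (long pair blocks =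
the up-sets generated by the pairs named in each section; 49 + 47 + 46 instances at p = 7), each with ONE law at every depth read off its machine-generated covers
(`decide` on the whole type lists, covers complete for every `p`): `A5P1745`: the V-gain with palindromic rows `vgainPal_of_cover` (`N = 6`, `R = 0`); `A5P172634`: the V-gain with palindromic rows `vgainPal_of_cover` (`N = 6`, `R = -2`); `A5P1734`: the V-gain with palindromic rows `vgainPal_of_cover` (`N = 6`, `R = -2`).  The node `⌊d/p⌋ − N_p − min([⌊d/p⌋ ≥ 2], 5 − C⋆)` is met at `⌊d/p⌋ ≤ 1`
(`C⋆` by new finite checks with six long parameters); the theorems carry `d < 2p` (the depth `⌊d/p⌋ = 2` of these profiles is left open).  p-UNIFORM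
hypotheses (lead l.9565): stratum + ORDER conditions + depth only.  Results: `pathAccounting_profile<X>` (every `j`) and
`pathAccountingFirstPeriod_profile<X>`.  MODEL/structure-side valuation bookkeeping of the cell's own rationals; nothing about ζ(5); no γ; records
in print UNMOVED.
-/

open Finset

namespace Summit.KontsevichZagierPeriods.Zeta5Search.FullProfile

open Summit.KontsevichZagierPeriods.Zeta5Search.ClusterValuation
open Summit.KontsevichZagierPeriods.Zeta5Search.CasoratianValuation (InPolytope shift casoratian pairFloors refund)
open Summit.KontsevichZagierPeriods.Zeta5Search.WedgeDictionary (dOf)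
open Summit.KontsevichZagierPeriods.Zeta5Search.ClassTypeCover
open Summit.KontsevichZagierPeriods.Zeta5Search.DenomLaw (cStar FirstPeriod Sorted7 vgain_of_cover vgainPal_of_cover cover_A3K cover_A4)
open Summit.KontsevichZagierPeriods.Zeta5Search.DenomLaw.FirstPeriodKit (sorted7_chain firstPeriod_pair pairFloors_expand)
open Summit.KontsevichZagierPeriods.Zeta5Search.SortedProfile
/-! ## The a = 5 profile `A5P1745`: long pair blocks generated by [(1, 7), (4, 5)] (maximal short [(3, 6)]); `N_p = 9`, `C⋆ ≤ 8` -/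

section A5P1745

variable {b : ℕ → ℤ} {j p : ℕ}

/-- **`C⋆ ≤ 8` on `A5P1745`** (5 long parameters `b_6 < p ≤ b_5`; every pair block below one of the short pairs [(3, 6)] is short): the finite check over
the 5,040 orderings (`decide +kernel`). -/
theorem cStar_le_eight_A5P1745 {b : ℕ → ℤ} {p : ℕ} (hs : Sorted7 b) (hA : b 6 < (p : ℤ)) (hS36 : b 0 < (p : ℤ) + b 3 + b 6) : cStar b p ≤ 8 := by
  obtain ⟨h21, h32, h43, h54, h65, h76⟩ := sorted7_chain hs
  refine DenomLaw.FirstPeriodKit.cStar_le_of_profile (fun i => i.val + 1 ≤ 5)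
    (fun i k => ¬ (((i.val + 1 ≤ 3 ∧ k.val + 1 ≤ 6) ∨ (k.val + 1 ≤ 3 ∧ i.val + 1 ≤ 6)) ∧ i.val ≠ k.val)) 8 ?_ ?_ (by decide +kernel)
  · intro i h
    have := i.isLt
    by_contra hc
    interval_cases hv : i.val <;> simp only [Nat.reduceAdd] at h hc <;> omega
  · intro i k hik h
    obtain ⟨hsh, hne⟩ := h
    have := i.isLt; have := k.isLt
    exfalso
    rcases hsh with ⟨h1, h2⟩ | ⟨h1, h2⟩ <;> interval_cases hv : i.val <;> interval_cases hw : k.val <;> simp only [Nat.reduceAdd] at hik h1 h2 <;> omega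

/-- **The V-GAIN law on `A5P1745`, general `b`, every depth**: `v_p(Cas_j(b)) ≥ -5`, and `≥ -5` for `p ≤ d` (gen 10's `checkB` at `N = 6` and the
row check at `R = 0`, `decide`d on both covers; gen 23's `DenomLaw.vgainPal_of_cover`). -/
theorem cas_geA5P1745 (hb : InPolytope b) (hs : Sorted7 b) (hbj : InPolytope (shift b j)) (hj1 : 1 ≤ j) (hj7 : j ≤ 7)
    (hprime : p.Prime) (hp5 : 5 ≤ p) (hwin : (b 0 + 2 : ℤ) < (p : ℤ) ^ 2) (hA : b 6 < (p : ℤ)) (hA5 : (p : ℤ) ≤ b 5) (hL17 : (p : ℤ) + b 1 + b 7 ≤ b 0) (hL45 : (p : ℤ) + b 4 + b 5 ≤ b 0) (hS36 : b 0 < (p : ℤ) + b 3 + b 6)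
    (hF1 : b 1 < 2 * (p : ℤ)) (hF2 : b 0 < 2 * (p : ℤ) + b 6 + b 7) (hcas : casoratian b j ≠ 0) :
    -5 + (if (p : ℤ) ≤ dOf b then (0 : ℤ) else 0) ≤ padicValRat p (casoratian b j) := by
  haveI : Fact p.Prime := ⟨hprime⟩
  have hp2 : p % 2 = 1 := Nat.odd_iff.1 (hprime.odd_of_ne_two (by omega))
  obtain ⟨h21, h32, h43, h54, h65, h76⟩ := sorted7_chain hs
  obtain ⟨h0, hb1, hb2, hb3, hb4, hb5, hb6, hb7, hc1⟩ := box hb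
  have hpb : (p : ℤ) ≤ b 0 := by linarith
  have hmin : min (0 : ℤ) 0 = 0 := by norm_num
  rcases Int.emod_two_eq_zero_or_one (b 0) with hr | hr
  · have h := vgainPal_of_cover hb hj1 hj7 hbj hp5 hpb hwin (coverA5P1745_ev hb hs hA hA5 hL17 hL45 hS36 hF1 hF2 hp5 hp2 hr) (N := 6) (by norm_num) ⟨3, rfl⟩
      (by rw [oddFlag_false hr]; decide) (0) (by norm_num) (by rw [oddFlag_false hr]; decide) hcas
    rw [hmin] at h; push_cast at h; split_ifs at h ⊢ <;> linarith
  · have h := vgainPal_of_cover hb hj1 hj7 hbj hp5 hpb hwin (coverA5P1745_od hb hs hA hA5 hL17 hL45 hS36 hF1 hF2 hp5 hp2 hr) (N := 6) (by norm_num) ⟨3, rfl⟩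
      (by rw [oddFlag_true hr]; decide) (0) (by norm_num) (by rw [oddFlag_true hr]; decide) hcas
    rw [hmin] at h; push_cast at h; split_ifs at h ⊢ <;> linarith

/-- **`PathAccountingFirstPeriod`'s conclusion on `A5P1745`, EVERY sorted `b`, every direction `j`, depth `d < 2p`** (`N_p = 9`, `C⋆ ≤ 8`; node `-6` at
`⌊d/p⌋ = 0`, `-5` at `⌊d/p⌋ = 1`). -/
theorem pathAccounting_profileA5P1745 (b : ℕ → ℤ) (j p : ℕ) (hb : InPolytope b) (hs : Sorted7 b) (hbj : InPolytope (shift b j))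
    (hj1 : 1 ≤ j) (hj7 : j ≤ 7) (hprime : p.Prime) (hp5 : 5 ≤ p) (hwin : (b 0 + 2 : ℤ) < (p : ℤ) ^ 2) (hfp : FirstPeriod b p)
    (hA : b 6 < (p : ℤ)) (hA5 : (p : ℤ) ≤ b 5) (hL17 : (p : ℤ) + b 1 + b 7 ≤ b 0) (hL45 : (p : ℤ) + b 4 + b 5 ≤ b 0) (hS36 : b 0 < (p : ℤ) + b 3 + b 6) (hd2 : dOf b < 2 * (p : ℤ))
    (hcas : casoratian b j ≠ 0) :
    dOf b / (p : ℤ) - pairFloors b p - min (if 2 ≤ dOf b / (p : ℤ) then (1 : ℤ) else 0) (5 - (cStar b p : ℤ))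
      ≤ padicValRat p (casoratian b j) := by
  obtain ⟨hF1, hF2⟩ := fp_bounds hfp
  have hp0 : (0 : ℤ) < p := by exact_mod_cast hprime.pos
  have hpf : pairFloors b p = 9 := by
    obtain ⟨h21, h32, h43, h54, h65, h76⟩ := sorted7_chain hs
    exact pairFloors_eq_9a hb hs hprime.pos hS36 hL17 hL45 hfp
  rw [hpf]
  have hC : (cStar b p : ℤ) ≤ 8 := by exact_mod_cast cStar_le_eight_A5P1745 hs hA hS36
  have hfd : dOf b / (p : ℤ) < 2 := by rw [Int.ediv_lt_iff_lt_mul hp0]; linarith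
  rw [if_neg (by omega)]
  have hmin : -3 ≤ min (0 : ℤ) (5 - (cStar b p : ℤ)) := le_min (by norm_num) (by linarith)
  have hlaw := cas_geA5P1745 hb hs hbj hj1 hj7 hprime hp5 hwin hA hA5 hL17 hL45 hS36 hF1 hF2 hcas
  by_cases h1 : (p : ℤ) ≤ dOf b
  · have hfd1 : dOf b / (p : ℤ) ≤ 1 := by omega
    rw [if_pos h1] at hlaw
    linarith
  · rw [if_neg h1] at hlaw
    push Not at h1
    have hd0 : 0 ≤ dOf b := by have := hb.2.2; unfold dOf; linarith
    have hfd0 : dOf b / (p : ℤ) = 0 := Int.ediv_eq_zero_of_lt hd0 h1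
    rw [hfd0]
    linarith

/-- **THE NODE ON `A5P1745` AT DEPTH `d < 2p`, EVERY SORTED `b`: `PathAccountingFirstPeriod` with its binders VERBATIM plus `b_6 < p ≤ b_5`, the profile's
ORDER conditions and `d < 2p`.** -/
theorem pathAccountingFirstPeriod_profileA5P1745 :
    ∀ (b : ℕ → ℤ) (p : ℕ), InPolytope b → Sorted7 b → InPolytope (shift b 7) →
      p.Prime → 5 ≤ p → (b 0 + 2 : ℤ) < (p : ℤ) ^ 2 → FirstPeriod b p →
      b 6 < (p : ℤ) → (p : ℤ) ≤ b 5 → (p : ℤ) + b 1 + b 7 ≤ b 0 → (p : ℤ) + b 4 + b 5 ≤ b 0 → b 0 < (p : ℤ) + b 3 + b 6 → dOf b < 2 * (p : ℤ) → casoratian b 7 ≠ 0 →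
        dOf b / (p : ℤ) - pairFloors b p - min (if 2 ≤ dOf b / (p : ℤ) then (1 : ℤ) else 0) (5 - (cStar b p : ℤ))
          ≤ padicValRat p (casoratian b 7) :=
  fun b p hb hs hb7 hprime hp5 hwin hfp hA hA5 hL17 hL45 hS36 hd2 hcas =>
    pathAccounting_profileA5P1745 b 7 p hb hs hb7 (by norm_num) (by norm_num) hprime hp5 hwin hfp hA hA5 hL17 hL45 hS36 hd2 hcas

end A5P1745

/-! ## The a = 5 profile `A5P172634`: long pair blocks generated by [(1, 7), (2, 6), (3, 4)] (maximal short [(1, 6), (2, 5)]); `N_p = 13`, `C⋆ ≤ 9` -/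

section A5P172634

variable {b : ℕ → ℤ} {j p : ℕ}

/-- **`C⋆ ≤ 9` on `A5P172634`** (5 long parameters `b_6 < p ≤ b_5`; every pair block below one of the short pairs [(1, 6), (2, 5)] is short): the finite check over
the 5,040 orderings (`decide +kernel`). -/
theorem cStar_le_nine_A5P172634 {b : ℕ → ℤ} {p : ℕ} (hs : Sorted7 b) (hA : b 6 < (p : ℤ)) (hS16 : b 0 < (p : ℤ) + b 1 + b 6) (hS25 : b 0 < (p : ℤ) + b 2 + b 5) : cStar b p ≤ 9 := by
  obtain ⟨h21, h32, h43, h54, h65, h76⟩ := sorted7_chain hs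
  refine DenomLaw.FirstPeriodKit.cStar_le_of_profile (fun i => i.val + 1 ≤ 5)
    (fun i k => ¬ (((i.val + 1 ≤ 1 ∧ k.val + 1 ≤ 6) ∨ (k.val + 1 ≤ 1 ∧ i.val + 1 ≤ 6) ∨ (i.val + 1 ≤ 2 ∧ k.val + 1 ≤ 5) ∨ (k.val + 1 ≤ 2 ∧ i.val + 1 ≤ 5)) ∧ i.val ≠ k.val)) 9 ?_ ?_ (by decide +kernel)
  · intro i h
    have := i.isLt
    by_contra hc
    interval_cases hv : i.val <;> simp only [Nat.reduceAdd] at h hc <;> omega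
  · intro i k hik h
    obtain ⟨hsh, hne⟩ := h
    have := i.isLt; have := k.isLt
    exfalso
    rcases hsh with ⟨h1, h2⟩ | ⟨h1, h2⟩ | ⟨h1, h2⟩ | ⟨h1, h2⟩ <;> interval_cases hv : i.val <;> interval_cases hw : k.val <;> simp only [Nat.reduceAdd] at hik h1 h2 <;> omega

/-- **The V-GAIN law on `A5P172634`, general `b`, every depth**: `v_p(Cas_j(b)) ≥ -7`, and `≥ -7` for `p ≤ d` (gen 10's `checkB` at `N = 6` and the
row check at `R = -2`, `decide`d on both covers; gen 23's `DenomLaw.vgainPal_of_cover`). -/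
theorem cas_geA5P172634 (hb : InPolytope b) (hs : Sorted7 b) (hbj : InPolytope (shift b j)) (hj1 : 1 ≤ j) (hj7 : j ≤ 7)
    (hprime : p.Prime) (hp5 : 5 ≤ p) (hwin : (b 0 + 2 : ℤ) < (p : ℤ) ^ 2) (hA : b 6 < (p : ℤ)) (hA5 : (p : ℤ) ≤ b 5) (hL17 : (p : ℤ) + b 1 + b 7 ≤ b 0) (hL26 : (p : ℤ) + b 2 + b 6 ≤ b 0) (hL34 : (p : ℤ) + b 3 + b 4 ≤ b 0) (hS16 : b 0 < (p : ℤ) + b 1 + b 6) (hS25 : b 0 < (p : ℤ) + b 2 + b 5)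
    (hF1 : b 1 < 2 * (p : ℤ)) (hF2 : b 0 < 2 * (p : ℤ) + b 6 + b 7) (hcas : casoratian b j ≠ 0) :
    -7 + (if (p : ℤ) ≤ dOf b then (0 : ℤ) else 0) ≤ padicValRat p (casoratian b j) := by
  haveI : Fact p.Prime := ⟨hprime⟩
  have hp2 : p % 2 = 1 := Nat.odd_iff.1 (hprime.odd_of_ne_two (by omega))
  obtain ⟨h21, h32, h43, h54, h65, h76⟩ := sorted7_chain hs
  obtain ⟨h0, hb1, hb2, hb3, hb4, hb5, hb6, hb7, hc1⟩ := box hb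
  have hpb : (p : ℤ) ≤ b 0 := by linarith
  have hmin : min (-2 : ℤ) 0 = -2 := by norm_num
  rcases Int.emod_two_eq_zero_or_one (b 0) with hr | hr
  · have h := vgainPal_of_cover hb hj1 hj7 hbj hp5 hpb hwin (coverA5P172634_ev hb hs hA hA5 hL17 hL26 hL34 hS16 hS25 hF1 hF2 hp5 hp2 hr) (N := 6) (by norm_num) ⟨3, rfl⟩
      (by rw [oddFlag_false hr]; decide) (-2) (by norm_num) (by rw [oddFlag_false hr]; decide) hcas
    rw [hmin] at h; push_cast at h; split_ifs at h ⊢ <;> linarith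
  · have h := vgainPal_of_cover hb hj1 hj7 hbj hp5 hpb hwin (coverA5P172634_od hb hs hA hA5 hL17 hL26 hL34 hS16 hS25 hF1 hF2 hp5 hp2 hr) (N := 6) (by norm_num) ⟨3, rfl⟩
      (by rw [oddFlag_true hr]; decide) (-2) (by norm_num) (by rw [oddFlag_true hr]; decide) hcas
    rw [hmin] at h; push_cast at h; split_ifs at h ⊢ <;> linarith

/-- **`PathAccountingFirstPeriod`'s conclusion on `A5P172634`, EVERY sorted `b`, every direction `j`, depth `d < 2p`** (`N_p = 13`, `C⋆ ≤ 9`; node `-9` at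
`⌊d/p⌋ = 0`, `-8` at `⌊d/p⌋ = 1`). -/
theorem pathAccounting_profileA5P172634 (b : ℕ → ℤ) (j p : ℕ) (hb : InPolytope b) (hs : Sorted7 b) (hbj : InPolytope (shift b j))
    (hj1 : 1 ≤ j) (hj7 : j ≤ 7) (hprime : p.Prime) (hp5 : 5 ≤ p) (hwin : (b 0 + 2 : ℤ) < (p : ℤ) ^ 2) (hfp : FirstPeriod b p)
    (hA : b 6 < (p : ℤ)) (hA5 : (p : ℤ) ≤ b 5) (hL17 : (p : ℤ) + b 1 + b 7 ≤ b 0) (hL26 : (p : ℤ) + b 2 + b 6 ≤ b 0) (hL34 : (p : ℤ) + b 3 + b 4 ≤ b 0) (hS16 : b 0 < (p : ℤ) + b 1 + b 6) (hS25 : b 0 < (p : ℤ) + b 2 + b 5) (hd2 : dOf b < 2 * (p : ℤ))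
    (hcas : casoratian b j ≠ 0) :
    dOf b / (p : ℤ) - pairFloors b p - min (if 2 ≤ dOf b / (p : ℤ) then (1 : ℤ) else 0) (5 - (cStar b p : ℤ))
      ≤ padicValRat p (casoratian b j) := by
  obtain ⟨hF1, hF2⟩ := fp_bounds hfp
  have hp0 : (0 : ℤ) < p := by exact_mod_cast hprime.pos
  have hpf : pairFloors b p = 13 := by
    obtain ⟨h21, h32, h43, h54, h65, h76⟩ := sorted7_chain hs
    exact pairFloors_eq_13d hb hs hprime.pos hS16 hS25 hL17 hL26 hL34 hfp
  rw [hpf]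
  have hC : (cStar b p : ℤ) ≤ 9 := by exact_mod_cast cStar_le_nine_A5P172634 hs hA hS16 hS25
  have hfd : dOf b / (p : ℤ) < 2 := by rw [Int.ediv_lt_iff_lt_mul hp0]; linarith
  rw [if_neg (by omega)]
  have hmin : -4 ≤ min (0 : ℤ) (5 - (cStar b p : ℤ)) := le_min (by norm_num) (by linarith)
  have hlaw := cas_geA5P172634 hb hs hbj hj1 hj7 hprime hp5 hwin hA hA5 hL17 hL26 hL34 hS16 hS25 hF1 hF2 hcas
  by_cases h1 : (p : ℤ) ≤ dOf b
  · have hfd1 : dOf b / (p : ℤ) ≤ 1 := by omega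
    rw [if_pos h1] at hlaw
    linarith
  · rw [if_neg h1] at hlaw
    push Not at h1
    have hd0 : 0 ≤ dOf b := by have := hb.2.2; unfold dOf; linarith
    have hfd0 : dOf b / (p : ℤ) = 0 := Int.ediv_eq_zero_of_lt hd0 h1
    rw [hfd0]
    linarith

/-- **THE NODE ON `A5P172634` AT DEPTH `d < 2p`, EVERY SORTED `b`: `PathAccountingFirstPeriod` with its binders VERBATIM plus `b_6 < p ≤ b_5`, the profile's
ORDER conditions and `d < 2p`.** -/
theorem pathAccountingFirstPeriod_profileA5P172634 :
    ∀ (b : ℕ → ℤ) (p : ℕ), InPolytope b → Sorted7 b → InPolytope (shift b 7) →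
      p.Prime → 5 ≤ p → (b 0 + 2 : ℤ) < (p : ℤ) ^ 2 → FirstPeriod b p →
      b 6 < (p : ℤ) → (p : ℤ) ≤ b 5 → (p : ℤ) + b 1 + b 7 ≤ b 0 → (p : ℤ) + b 2 + b 6 ≤ b 0 → (p : ℤ) + b 3 + b 4 ≤ b 0 → b 0 < (p : ℤ) + b 1 + b 6 → b 0 < (p : ℤ) + b 2 + b 5 → dOf b < 2 * (p : ℤ) → casoratian b 7 ≠ 0 →
        dOf b / (p : ℤ) - pairFloors b p - min (if 2 ≤ dOf b / (p : ℤ) then (1 : ℤ) else 0) (5 - (cStar b p : ℤ))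
          ≤ padicValRat p (casoratian b 7) :=
  fun b p hb hs hb7 hprime hp5 hwin hfp hA hA5 hL17 hL26 hL34 hS16 hS25 hd2 hcas =>
    pathAccounting_profileA5P172634 b 7 p hb hs hb7 (by norm_num) (by norm_num) hprime hp5 hwin hfp hA hA5 hL17 hL26 hL34 hS16 hS25 hd2 hcas

end A5P172634

/-! ## The a = 5 profile `A5P1734`: long pair blocks generated by [(1, 7), (3, 4)] (maximal short [(2, 6)]); `N_p = 12`, `C⋆ ≤ 9` -/

section A5P1734

variable {b : ℕ → ℤ} {j p : ℕ}

/-- **`C⋆ ≤ 9` on `A5P1734`** (5 long parameters `b_6 < p ≤ b_5`; every pair block below one of the short pairs [(2, 6)] is short): the finite check over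
the 5,040 orderings (`decide +kernel`). -/
theorem cStar_le_nine_A5P1734 {b : ℕ → ℤ} {p : ℕ} (hs : Sorted7 b) (hA : b 6 < (p : ℤ)) (hS26 : b 0 < (p : ℤ) + b 2 + b 6) : cStar b p ≤ 9 := by
  obtain ⟨h21, h32, h43, h54, h65, h76⟩ := sorted7_chain hs
  refine DenomLaw.FirstPeriodKit.cStar_le_of_profile (fun i => i.val + 1 ≤ 5)
    (fun i k => ¬ (((i.val + 1 ≤ 2 ∧ k.val + 1 ≤ 6) ∨ (k.val + 1 ≤ 2 ∧ i.val + 1 ≤ 6)) ∧ i.val ≠ k.val)) 9 ?_ ?_ (by decide +kernel)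
  · intro i h
    have := i.isLt
    by_contra hc
    interval_cases hv : i.val <;> simp only [Nat.reduceAdd] at h hc <;> omega
  · intro i k hik h
    obtain ⟨hsh, hne⟩ := h
    have := i.isLt; have := k.isLt
    exfalso
    rcases hsh with ⟨h1, h2⟩ | ⟨h1, h2⟩ <;> interval_cases hv : i.val <;> interval_cases hw : k.val <;> simp only [Nat.reduceAdd] at hik h1 h2 <;> omega

/-- **The V-GAIN law on `A5P1734`, general `b`, every depth**: `v_p(Cas_j(b)) ≥ -7`, and `≥ -7` for `p ≤ d` (gen 10's `checkB` at `N = 6` and the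
row check at `R = -2`, `decide`d on both covers; gen 23's `DenomLaw.vgainPal_of_cover`). -/
theorem cas_geA5P1734 (hb : InPolytope b) (hs : Sorted7 b) (hbj : InPolytope (shift b j)) (hj1 : 1 ≤ j) (hj7 : j ≤ 7)
    (hprime : p.Prime) (hp5 : 5 ≤ p) (hwin : (b 0 + 2 : ℤ) < (p : ℤ) ^ 2) (hA : b 6 < (p : ℤ)) (hA5 : (p : ℤ) ≤ b 5) (hL17 : (p : ℤ) + b 1 + b 7 ≤ b 0) (hL34 : (p : ℤ) + b 3 + b 4 ≤ b 0) (hS26 : b 0 < (p : ℤ) + b 2 + b 6)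
    (hF1 : b 1 < 2 * (p : ℤ)) (hF2 : b 0 < 2 * (p : ℤ) + b 6 + b 7) (hcas : casoratian b j ≠ 0) :
    -7 + (if (p : ℤ) ≤ dOf b then (0 : ℤ) else 0) ≤ padicValRat p (casoratian b j) := by
  haveI : Fact p.Prime := ⟨hprime⟩
  have hp2 : p % 2 = 1 := Nat.odd_iff.1 (hprime.odd_of_ne_two (by omega))
  obtain ⟨h21, h32, h43, h54, h65, h76⟩ := sorted7_chain hs
  obtain ⟨h0, hb1, hb2, hb3, hb4, hb5, hb6, hb7, hc1⟩ := box hb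
  have hpb : (p : ℤ) ≤ b 0 := by linarith
  have hmin : min (-2 : ℤ) 0 = -2 := by norm_num
  rcases Int.emod_two_eq_zero_or_one (b 0) with hr | hr
  · have h := vgainPal_of_cover hb hj1 hj7 hbj hp5 hpb hwin (coverA5P1734_ev hb hs hA hA5 hL17 hL34 hS26 hF1 hF2 hp5 hp2 hr) (N := 6) (by norm_num) ⟨3, rfl⟩
      (by rw [oddFlag_false hr]; decide) (-2) (by norm_num) (by rw [oddFlag_false hr]; decide) hcas
    rw [hmin] at h; push_cast at h; split_ifs at h ⊢ <;> linarith
  · have h := vgainPal_of_cover hb hj1 hj7 hbj hp5 hpb hwin (coverA5P1734_od hb hs hA hA5 hL17 hL34 hS26 hF1 hF2 hp5 hp2 hr) (N := 6) (by norm_num) ⟨3, rfl⟩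
      (by rw [oddFlag_true hr]; decide) (-2) (by norm_num) (by rw [oddFlag_true hr]; decide) hcas
    rw [hmin] at h; push_cast at h; split_ifs at h ⊢ <;> linarith

/-- **`PathAccountingFirstPeriod`'s conclusion on `A5P1734`, EVERY sorted `b`, every direction `j`, depth `d < 2p`** (`N_p = 12`, `C⋆ ≤ 9`; node `-8` at
`⌊d/p⌋ = 0`, `-7` at `⌊d/p⌋ = 1`). -/
theorem pathAccounting_profileA5P1734 (b : ℕ → ℤ) (j p : ℕ) (hb : InPolytope b) (hs : Sorted7 b) (hbj : InPolytope (shift b j))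
    (hj1 : 1 ≤ j) (hj7 : j ≤ 7) (hprime : p.Prime) (hp5 : 5 ≤ p) (hwin : (b 0 + 2 : ℤ) < (p : ℤ) ^ 2) (hfp : FirstPeriod b p)
    (hA : b 6 < (p : ℤ)) (hA5 : (p : ℤ) ≤ b 5) (hL17 : (p : ℤ) + b 1 + b 7 ≤ b 0) (hL34 : (p : ℤ) + b 3 + b 4 ≤ b 0) (hS26 : b 0 < (p : ℤ) + b 2 + b 6) (hd2 : dOf b < 2 * (p : ℤ))
    (hcas : casoratian b j ≠ 0) :
    dOf b / (p : ℤ) - pairFloors b p - min (if 2 ≤ dOf b / (p : ℤ) then (1 : ℤ) else 0) (5 - (cStar b p : ℤ))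
      ≤ padicValRat p (casoratian b j) := by
  obtain ⟨hF1, hF2⟩ := fp_bounds hfp
  have hp0 : (0 : ℤ) < p := by exact_mod_cast hprime.pos
  have hpf : pairFloors b p = 12 := by
    obtain ⟨h21, h32, h43, h54, h65, h76⟩ := sorted7_chain hs
    exact pairFloors_eq_12b hb hs hprime.pos hS26 hL17 hL34 hfp
  rw [hpf]
  have hC : (cStar b p : ℤ) ≤ 9 := by exact_mod_cast cStar_le_nine_A5P1734 hs hA hS26
  have hfd : dOf b / (p : ℤ) < 2 := by rw [Int.ediv_lt_iff_lt_mul hp0]; linarith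
  rw [if_neg (by omega)]
  have hmin : -4 ≤ min (0 : ℤ) (5 - (cStar b p : ℤ)) := le_min (by norm_num) (by linarith)
  have hlaw := cas_geA5P1734 hb hs hbj hj1 hj7 hprime hp5 hwin hA hA5 hL17 hL34 hS26 hF1 hF2 hcas
  by_cases h1 : (p : ℤ) ≤ dOf b
  · have hfd1 : dOf b / (p : ℤ) ≤ 1 := by omega
    rw [if_pos h1] at hlaw
    linarith
  · rw [if_neg h1] at hlaw
    push Not at h1
    have hd0 : 0 ≤ dOf b := by have := hb.2.2; unfold dOf; linarith
    have hfd0 : dOf b / (p : ℤ) = 0 := Int.ediv_eq_zero_of_lt hd0 h1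
    rw [hfd0]
    linarith

/-- **THE NODE ON `A5P1734` AT DEPTH `d < 2p`, EVERY SORTED `b`: `PathAccountingFirstPeriod` with its binders VERBATIM plus `b_6 < p ≤ b_5`, the profile's
ORDER conditions and `d < 2p`.** -/
theorem pathAccountingFirstPeriod_profileA5P1734 :
    ∀ (b : ℕ → ℤ) (p : ℕ), InPolytope b → Sorted7 b → InPolytope (shift b 7) →
      p.Prime → 5 ≤ p → (b 0 + 2 : ℤ) < (p : ℤ) ^ 2 → FirstPeriod b p →
      b 6 < (p : ℤ) → (p : ℤ) ≤ b 5 → (p : ℤ) + b 1 + b 7 ≤ b 0 → (p : ℤ) + b 3 + b 4 ≤ b 0 → b 0 < (p : ℤ) + b 2 + b 6 → dOf b < 2 * (p : ℤ) → casoratian b 7 ≠ 0 →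
        dOf b / (p : ℤ) - pairFloors b p - min (if 2 ≤ dOf b / (p : ℤ) then (1 : ℤ) else 0) (5 - (cStar b p : ℤ))
          ≤ padicValRat p (casoratian b 7) :=
  fun b p hb hs hb7 hprime hp5 hwin hfp hA hA5 hL17 hL34 hS26 hd2 hcas =>
    pathAccounting_profileA5P1734 b 7 p hb hs hb7 (by norm_num) (by norm_num) hprime hp5 hwin hfp hA hA5 hL17 hL34 hS26 hd2 hcas

end A5P1734

end Summit.KontsevichZagierPeriods.Zeta5Search.FullProfile
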